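import Mathlib
import HarnessLib
import HarnessLib.Audit
import Summits.PneNP.Statement
import Literature.Computability.Complexity.Classes
import Literature.Computability.Complexity.Nondeterministic
import Literature.Computability.Complexity.CNF
import Literature.Computability.Complexity.BoolEncodings
import Literature.Computability.Complexity.Circuit
import Literature.Computability.Complexity.ConstantDepth
import Literature.Computability.Complexity.DecisionTree
import Literature.Computability.Complexity.CircuitLowerBounds
import Literature.Computability.Complexity.CliqueApproximators
import Literature.Computability.Complexity.NegationLimited
import HarnessLib.Audit.Status.Attr

/-!
Route: ORIncompressibility

DORMANT since 2026-08-23T17:11:34Z (reconciler: no traction for 6.1 d (last activity item-evidence-added at 2026-08-17T13:27:09Z); parked, not closed — `ledger route dormant route-PneNP-ORIncompressibility --off` to reactivate) — unstaffed, not closed; items shared with open routes are served there. `ledger route dormant <id> --off` reactivates.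

# Route PneNP/ORIncompressibility — "a thousand SAT puzzles cannot be distilled into one": P ≠ NP
from the OR-incompressibility of SAT (instance compression / kernelization lower bounds). Realises
idea card PneNP/PneNP/or-incompressibility-distillation.

## Thesis X (it suffices to show)
Words: SAT has no OR-compression — for every output budget a there is a block count c such that no
polynomial-time f maps every tuple of n^c length-n instances to a string of length ≤ n^a whose value
determines whether SOME instance of the tuple is satisfiable (pure fibres; no decoder is required:
the compressed string need only be a sufficient statistic for the OR).
Lean (decl NoORCompression, elaborates rc 0): ∀ a, ∃ c, ∀ f ∈
Literature.Computability.Complexity.FP, ∃ᶠ n, ∃ xs ys : List (List Bool) (n^c blocks of length n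
each), n^a < |f ⟨xs⟩| ∨ (f ⟨xs⟩ = f ⟨ys⟩ ∧ ¬((∃ x ∈ xs, x ∈ SAT) ↔ ∃ y ∈ ys, y ∈ SAT)); tuples are
encoded by iterated Literature.Computability.Complexity.boolPair.
Position: P = NP ⇒ ¬X (the 1-bit compressor x̄ ↦ [∃ i, x̄_i ∈ SAT]); coNP ⊄ NP/poly ⇒ X
(FortnowSanthanam2011 Thm 1.2 for OR; Drucker2015 for AND and bounded-error compressors) and even NP
⊄ coAM ⇒ X (Drucker2015 §9: ¬X supplies t = n^{1000a} blocks). Hence PH ≠ Σ₂ᵖ ⇒ X ⇒ P ≠ NP, and X is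
the weakest-looking member of that family: a statement about information bottlenecks of the most
primitive connective, not about deciding anything.

## Assembly X → PneNP
Assembly : OneBitCompressorOfNPSubsetP → NoORCompression → PneNP. ¬PneNP gives NP ⊆ P through the
PROVED bridges (P_bool_eq_holds, NP_bool_eq_holds, pneNP_shape_of_NP_not_subset_P); the support item
OneBitCompressorOfNPSubsetP (NP ⊆ P → (x̄ ↦ [∃ i, x̄_i ∈ SAT]) ∈ FP; TM plumbing over
SearchToDecision/PairProjections, no named fact) contradicts X at a = 0. The deciding theorem is
`closes : Assembly → OneBitCompressorOfNPSubsetP → NoORCompression → PneNP` (H21.Audit verdict ok: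
conclusion PneNP by name from 3 route items; repair 2026-08-15 — the rungs are no longer hypotheses
of `closes`).

## Two-layer plan (D-0019)
Layer 1 = the ranked crux STATEMENTS below; glue and splits come later and only under a crux that
closes. The rungs are stated for NON-UNIFORM restricted compressors in pure Boolean form — m
single-output circuits on t·n input bits whose joint value determines the OR of the t block
predicates — over the tree's Circuit / acBasis / accBasis p / tcBasis / DecisionTree; every rung
with output budget m ≤ t − 1 is implied by coNP ⊄ NP/poly (FS counting), so the ladder is consistent
with the thesis. Encoding caveat (learned from the refutation of the former TC⁰ rung): every SAT
codeword has length ≡ 2 (mod 4) (|⟨φ⟩| = 2 + 8·#clauses + 20·#literal-occurrences + 8·Σ bitlengths),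
so any rung or thesis over SAT blocks must be stated `∃ᶠ n` (as X is), never `∀ n ≥ n₀`;
parity-block rungs are unaffected. The TC⁰ rung (blocks must be SAT-hard for TC⁰, i.e. NP ⊄ TC⁰ in
compression clothing) is recorded as the natural-proofs wall in BARRIERS and deliberately not filed
as an item. ROUTE CHOICE (2026-08-15, after the refutation of the former item NoTC0CompressionSAT):
the depth axis ends at that wall; the NEGATION axis (monotoneBasis / deMorganBasis with
Circuit.negationCount ≤ β per output, blocks = ⌊√v⌋-CLIQUE instances as edge vectors over KEdge v,
index type Fin t × KEdge v) is decided by an elementary block-saturation argument and is filed as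
two SUPPORT theorems — NoMonotoneCompressionClique (m ≤ t − 1, the exact Fortnow–Santhanam budget,
unconditionally) and NoNegLimitedCompressionClique (β constant, m·v² ≤ t) — with the recorded
finding that the block surplus buys exactly log₂(t/m) − O(1) negations and no crux; the UNIFORM axis
is known up to NP ⊆ coAM (Drucker2015 §9). The live line is crux #2 (OR-direct-sum for
𝔽_p-polynomial maps), then crux #3 (NP = coNP from ¬X, i.e. derandomise Drucker's Arthur).

Rationale: WHY THIS LINE. Among all P≠NP-sufficient statements on the hub this is the only one about SUFFICIENT
STATISTICS (kernels): it imports the instance-compression toolbox (FortnowSanthanam2011,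
Drucker2015, DellVanmelkebeek2014, BuhrmanHitchcock2008 density dual) as summit technology, and —
the engine — the UNCONDITIONAL theory of compression by restricted circuits (DubrovIshai2006,
ChattopadhyaySanthanam2012, Oliveira–Santhanam doi:10.4230/LIPIcs.CCC.2015.124), which so far treats
single functions (Parity, Majority, MOD_q), pointed at FS's OR-of-instances regime. A compressor
must be correct on PRODUCT structure, so the surplus of blocks over output bits is a resource; the
block trick imports any Λ-hard h without proving anything about SAT; the remaining task per rung is
a statement about a composed function with a huge top OR and tiny bottom copies. ROUTE CHOICE
(2026-08-15, after the refutation of the TC⁰ rung NoTC0CompressionSAT): three axes were examined.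
(a) DEPTH (AC⁰ ⊂ AC⁰[p] ⊂ TC⁰): the third rung is the natural-proofs wall (corrected ∃ᶠ form =
non-uniform NP ⊄ TC⁰) — closed, not re-filed. (b) NEGATIONS (Markov1958/Fischer1975 interpolation
monotone ↔ general): DECIDED ELEMENTARILY — a block-saturation argument (Jukna 2004's
block-restriction move, doi:10.1016/j.ipl.2003.10.003, pointed at OR-pure sketches with a free
decoder) shows that any OR-pure family of m ≤ t − 1 MONOTONE circuits on t CLIQUE_{⌊√v⌋} blocks
computes CLIQUE on one block outright, so the Fortnow–Santhanam counting budget m < t is met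
UNCONDITIONALLY for an NP-complete block predicate, and the same saturation freezes up to log₂(t/m)
− O(1) NOT gates per output; beyond that the axis is route NegLimited's single-function axis shifted
by log₂ of the surplus. Filed as two SUPPORT theorems (provable now), not cruxes. (c) UNIFORMITY: ¬X
⇒ coNP ⊆ NP/poly (FS11) and, read today, ¬X ⇒ NP ⊆ coAM UNIFORMLY (Drucker2015 §9, Thm 9.16 in the
full-version numbering: deterministic OR-compression of n^{1000a} length-n SAT instances into n^a
bits, any target language — exactly ¬X's regime, since ¬X supplies every block exponent c), hence PH
= Σ₂ᵖ; the open end is #3 (NP = coNP). THE NEXT LINE is therefore crux #2 — the OR-direct-sum for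
𝔽_p-polynomial maps, the one rung where the block surplus is neither bookkeeping (as on the negation
axis) nor a wall (as on the depth axis) — followed by #3, now sharpened to "derandomise Drucker's
Arthur".
RANKED CRUXES. #2 NoACCpCompressionParity: no AC⁰_d[p] (p odd prime) OR-compression of t = n^5..n^k
parity blocks into t/n³ bits. Single-block incompressibility (m < n/polylog by fixing t−1 blocks) is
OS15 Thm 1.1 / ChattopadhyaySanthanam2012; the polynomial method alone provably stops at m ≳
n·polylog (under every distribution OR∘PAR_{t,n} has ε-approximate 𝔽_p-degree ≤ (p−1)n·log_p(1/ε):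
Razborov's OR-polynomial ∘ exact block parities), so the content is an OR-direct-sum theorem for
low-degree polynomial MAPS P : 𝔽_p^{tn} ⊇ {0,1}^{tn} → 𝔽_p^m with (approximately) pure fibres — the
fibre of P(0̄) must avoid every tuple with an odd block while the all-even set Z is an 𝔽₂-subspace:
a MOD_p-versus-MOD_2 tension for vector-valued maps, where Smolensky-type arguments have not been
run. #3 CompressionCollapse: ¬X ⇒ NP = coNP — FS08's open question. Position corrected today: ¬X
already gives coNP ⊆ NP/poly (FS11 Thm 1.2) AND the uniform NP ⊆ coAM (Drucker2015 §9 Thm 9.16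
[full-version numbering], via eligible combining functions mADDR, Sivakumar-style candidate
elimination, ALRS reconstruction and Valiant–Vazirani), so what #3 adds is exactly the
derandomisation of that Arthur–Merlin protocol (AM = NP is known only from E-hardness, the opposite
of an easiness hypothesis) or a direct NP-certificate for unsatisfiability extracted from the
compressor; census/density methods (¬X puts SAT ≤ᵖ_m-below sets of density 2^{N^ε}) remain the other
Approach. FORMER #4 NoTC0CompressionSAT (TC⁰ rung over SAT blocks): REFUTED AS STATED
(Theorems/ORIncompressibilityNoTC0CompressionSATRefutation, 2026-08-15; SAT codewords have length ≡
2 (mod 4), so at other block lengths [∃ i, block_i ∈ SAT] is constant and the `∀ n ≥ n₀ … ∃ impure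
pair` form fails with m = 0); in corrected ∃ᶠ form it is non-uniform NP ⊄ TC⁰ resp. a TC⁰
compression of SAT — breakthroughs both ways — so it stays dropped and is recorded as the wall in
BARRIERS; the route choice above replaces it by nothing on the depth axis, two support theorems on
the negation axis, and the sharpened #3 on the uniform axis.
SUPPORT (rank 8–9, provable now or routine): UntouchedBlock (query model, ten lines);
NoAC0CompressionParity (multi-switching + untouched block, budget t/n²); NoMonotoneCompressionClique
(NEW: monotone OR-pure sketches of t CLIQUE_{⌊√v⌋} blocks need m ≥ t outputs — block saturation +
cliqueSqrt_monotone_lowerBound (PROVED, 2^{v^{1/8}}) + GateList.const_or_exists_monotone_circuit;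
difficulty M); NoNegLimitedCompressionClique (NEW: same with ≤ β NOT gates per output, β constant,
m·v² ≤ t — saturation of the ≤ m(β+1)2^β monotone pieces of the circuits with frozen NOT gates,
NegationElimination.lean surgery; difficulty L); OneBitCompressorOfNPSubsetP (assembly plumbing);
Assembly (¬PneNP ⇒ NP ⊆ P ⇒ the 1-bit compressor contradicts X at a = 0).
KILL CRITERIA. An FP OR-compression of SAT (refutes X; by FS11 + Drucker §9 it puts NP ⊆ coAM,
collapsing PH to the second level uniformly (BoppanaHastadZachos1987) — route closed); an AC⁰[⊕]- or
AC⁰[3]-compression of OR∘MOD blocks into o(t/poly n) bits (kills #2; a surprising upper bound); a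
proof that #2 reduces verbatim to single-block Razborov–Smolensky/OS15 bounds with no use of the
product structure — as happened today to the negation axis (saturation) — then the ladder is
bookkeeping and the route is a variant of Circuit: close as superseded; a poly-size OR-pure monotone
or O(1)-negation sketch of CLIQUE tuples within budget (refutes a SUPPORT theorem whose proof is in
hand — would mean the proof sketch is wrong, re-examine at once).
NOT DECOMPOSED YET. Under #2: the vector-valued Smolensky step (codimension/fibre structure of
low-degree maps on an 𝔽₂-subspace), the approximate-purity transfer (Razborov approximation under a
Z-straddling distribution), and the AC⁰[p]-to-polynomial-map reduction — glue only after #2 closes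
or is split. Under #3: the MA rung (¬X ⇒ coNP ⊆ MA) and advice-length rungs (coNP ⊆ NP/log) between
Drucker's coAM and NP; the density dual (BuhrmanHitchcock2008; Mahaney/Ogiwara–Watanabe census up to
polynomial density); AND-compression and probabilistic compressors (Drucker's distributional
stability). On the negation axis nothing further is filed: budgets beyond log₂(t/m) NOT gates per
output are route NegLimited's cruxes in costume (single-function r-hard pairs), and single-block
monotone SKETCH WIDTH ≥ 2n+2 would already imply NP ⊄ P/poly (Berkowitz slice functions: thresholds
+ slice circuits give a pure width-(2n+2) monotone sketch from any poly-size circuit) — recorded as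
the wall of that axis. SAT-block versions of any rung only in ∃ᶠ-form (lengths ≡ 2 mod 4; padding
gadgets of gcd 4). No definition requests: everything is typed over existing decls (KEdge, cliqueFn,
monotoneBasis, deMorganBasis, Circuit.negationCount).
CHEAPEST FALSIFIER. For #2: an explicit AC⁰[3] family with ≤ t/n³ outputs whose fibres separate the
all-even subspace Z from its complement at t = n^5 — try 𝔽₂-linear sketches first (they provably
need ≥ tn/polylog outputs) and then MOD₃-of-ANDs designs; equivalently, a degree-polylog polynomial
map 𝔽₃^{tn} → 𝔽₃^{t/n³} whose P(0̄)-fibre on {0,1}^{tn} lies inside Z. For #3: check whether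
Drucker's §9 protocol is already MA or derandomisable under ¬X itself (PH = Σ₂ᵖ holds under ¬X) — a
literature/one-page check before any ideation. For the new support items: the m = 0 / t = 1 / v < 4
corners (handled: v ≥ v₀ ≥ 4, t ≥ 1) — the kind of degeneracy that refuted the TC⁰ rung; no
residue-class issue since blocks are raw edge vectors. For X itself only a PH-collapsing FP
compressor refutes.

Novelty: Searches run. 2026-08-15 (opening planner): lit galaxy search "OR-compression" --star all, "instance
compression" --star pdf, bm25 "unconditional lower bounds for instance compression by restricted
compressors"; hub cards + theses grep compression/kernel/distillation (none). 2026-08-15 (route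
choice): lit search --source crossref/s2 "negation-limited circuits k-fold extension superpolynomial
savings Jukna" (found Jukna 2004 doi:10.1016/j.ipl.2003.10.003; Jukna–Lingas STACS 2019
doi:10.4230/lipics.stacs.2019.41 = JCSS 2022 doi:10.1016/j.jcss.2022.05.003, negation WIDTH;
Beals–Nishino–Tanaka doi:10.1145/225058.225276), s2 "instance compression lower bounds monotone
circuits negations" (Cavalar–Kumar–Rossman arXiv:2012.03883; Koroth–Sarma arXiv:1404.7443
orientation; nothing joining compression with monotone/negation-limited compressors), lit read
doi:10.1137/130927115 (Drucker, full version, §9 pp. 66–90: Thm 9.2 eligible f, Thm 9.16 OR/AND ⇒ NP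
⊆ coAM), hub: route NegLimited + cards hazard-budget-ladder, or-incompressibility-distillation
(spine), 97 open cards grep negation/compression; searchd/galaxy intermittently rc 75; want filed
acq-04558 (Jukna–Lingas).
Nearest prior art FOUND. (i) CONDITIONAL theory: FortnowSanthanam2011
(doi:10.1016/j.jcss.2010.06.007: OR-compression ⇒ coNP ⊆ NP/poly; open question = crux
CompressionCollapse), Drucker2015 (doi:10.1137/130927115: probabilistic AND/OR, SZK/poly, and — §9 —
the UNIFORM NP ⊆ coAM from high-quality deterministic-or-low-erro  [refs: 10.1016/j.ipl.2003.10.003, 10.4230/lipics.stacs.2019.41, 10.1016/j.jcss.2022.05.003, 10.1145/225058.225276, 10.1137/130927115, 10.1016/j.jcss.2010.06.007:, 10.1137/130927115:, 10.1145/2629620, 10.1109/ccc.2008.21, 10.1145/1132516.1132615, 10.1109/FOCS.2012.74, 10.4230/LIPIcs.CCC.2015.124, 10.1016/j.ipl.2003.10.003:, 2012.03883, 1404.7443, doi:10.1016/j.ipl.2003.10.003, doi:10.4230/lipics.stacs.201]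

Barriers (technique_class: instance-compression,polynomial-method,negation-limited): - technique_class: instance-compression,polynomial-method,negation-limited
- Literature.Barriers.PneNP.Locality: its `blocks` clause is hardness magnification via HM Frontier
E for (n−k)-Clique; no magnification step is used here — block-embedding imports hardness of h INTO
tuples (the opposite direction) and no rung passes through a kernel/locality threshold.
Switching-lemma technology is engaged only in the AC⁰ support rung, where it is unobstructed.
- Literature.Barriers.PneNP.NaturalProofs / Literature.Barriers.PneNP.NaturalProofsTC0: apply to
RUNG technology, not formally to X (uniform maps with pure fibres, not truth tables). Depth axis:
restriction/polynomial-method rungs are natural, hence capped below TC⁰ — the former item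
NoTC0CompressionSAT (refuted AS STATED on an encoding degeneracy, not re-filed in corrected ∃ᶠ form)
is exactly that wall (non-uniform SAT ∉ TC⁰_d under TC⁰ PRFs). Not evaded; this is why the route
choice of 2026-08-15 left the depth axis. Negation axis: monotone and O(1)-negation circuit classes
compute no PRF (a PRF needs log₂ n − O(1) NOT gates), so Razborov–Rudich does not apply to the two
new support theorems; their ceiling is a different wall (next two entries).
- Literature.Barriers.PneNP.MonotoneGap / Literature.Barriers.PneNP.NegationLimitedGap: monotone and
(log n − O(log log n))-negation lower bounds do not transfer to general circuits (Tardos1988; Jukna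
2004). Not engaged as a transfer: NoMonotoneCompressionClique / NoNegLimitedCompress

History (route lifecycle, newest last):
- 2026-08-15T10:53:06Z · BROKEN — NoTC0CompressionSAT (stmt-PneNP-0988, crux) refuted by Summit.PneNP.PneNP.Theorems.ORIncompressibilityNoTC0CompressionSAT_refuted @ b199f26fbc0d (refuter-rreview-route-ValiantsHypothesis-884d3839-0)
- 2026-08-15T17:59:46Z · rev 3: dropped NoTC0CompressionSAT — repair: drop NoTC0CompressionSAT (stmt-PneNP-0988, refuted-misstated: SAT codewords have length ≡ 2 mod 4 so the ∀-large-n form is vacuous; corrected ∃ᶠ form = (planner-rbadge-PneNP-ORIncompressibility-d84dfd69-0)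
- 2026-08-15T17:59:46Z · REPAIRED (drop NoTC0CompressionSAT) — back to open: repair: drop NoTC0CompressionSAT (stmt-PneNP-0988, refuted-misstated: SAT codewords have length ≡ 2 mod 4 so the ∀-large-n form is vacuous; corrected ∃ᶠ form = (planner-rbadge-PneNP-ORIncompressibility-d84dfd69-0)
- 2026-08-16T04:14:31Z · AUTO-CRUX (backfill): NoORCompression — hypotheses of the deciding theorem that nothing in the route derives are cruxes (operator:999:1085951)
- 2026-08-23T17:11:34Z · DORMANT — reconciler: no traction for 6.1 d (last activity item-evidence-added at 2026-08-17T13:27:09Z); parked, not closed — `ledger route dormant route-PneNP-ORIncompre (operator:999:3909752)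

sub-problem: PneNP · status: dormant · opened planner-plancards-PneNP-PneNP-20260815w1-1-0 2026-08-15T10:38:56Z · rev 6 · ledger route-PneNP-ORIncompressibility
GENERATED by the gate from the ledger (D-0016/17). Provers cite these decls: `theorem foo : Summit.PneNP.PneNP.Theses.ORIncompressibility.<Decl> := …` in Summits/PneNP/PneNP/Theorems/<Name>.lean.
-/

namespace Summit.PneNP.PneNP.Theses.ORIncompressibility

open scoped BigOperators Topology Manifold Classical MeasureTheory ProbabilityTheory Matrix InnerProductSpace ComplexConjugate ContinuousMap
open Filter Set Function TopologicalSpace MeasureTheory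

attribute [summit_statement] _root_.PneNP

open Literature.PNP

/-- item stmt-PneNP-0985 · crux (kind.auto-crux: conjecture-grade) · rank 0 · open · by planner
why it might fail: Summit-strength (X ⇒ P≠NP) and possibly FALSE with P≠NP true: a pure OR-compressor decides nothing, and only NP ⊄ coAM-type hypotheses are known to imply X (FS11 Thm 1.2; Drucker15 §9). SAT codewords have length ≡ 2 (mod 4), so X lives on those n only — the ∃ᶠ form is essential.
sources: FortnowSanthanam2011, Drucker2015, DellVanmelkebeek2014, BuhrmanHitchcock2008
[target] Thesis X of route ORIncompressibility (card PneNP/PneNP/or-incompressibility-distillation):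
SAT has no OR-compression — for every output budget a there is c such that every f ∈ FP fails
infinitely often on tuples of n^c instances of length n (tuple encoded as xs.foldr boolPair []):
either |f| > n^a or two tuples with the same image differ on [some block ∈ SAT]. Quantifier order
per refuter-triage-14 correction (budget a bound BEFORE c, so the identity map is no witness). P =
NP ⇒ ¬X (1-bit compressor); coNP ⊄ NP/poly ⇒ X [FortnowSanthanam2011 Thm 1.2; Drucker2015 Thm 1.1].
Sources: FortnowSanthanam2011; Drucker2015; DellVanmelkebeek2014; BuhrmanHitchcock2008. -/
@[route_item "route-PneNP-ORIncompressibility", crux]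
def NoORCompression : Prop :=
  ∀ a : ℕ, ∃ c : ℕ, ∀ f ∈ Literature.Computability.Complexity.FP, ∃ᶠ n : ℕ in Filter.atTop, ∃ xs ys : List (List Bool), (xs.length = n ^ c ∧ ∀ x ∈ xs, x.length = n) ∧ (ys.length = n ^ c ∧ ∀ y ∈ ys, y.length = n) ∧ (n ^ a < (f (xs.foldr Literature.Computability.Complexity.boolPair [])).length ∨ (f (xs.foldr Literature.Computability.Complexity.boolPair []) = f (ys.foldr Literature.Computability.Complexity.boolPair []) ∧ ¬ ((∃ x ∈ xs, x ∈ Literature.Computability.Complexity.SAT) ↔ ∃ y ∈ ys, y ∈ Literature.Computability.Complexity.SAT)))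

/-- item stmt-PneNP-0986 · crux · rank 2 · open · by planner
why it might fail: OR∘PAR_{t,n} has approximate 𝔽_p-degree ≤ (p−1)n·log_p(1/ε) under EVERY distribution (Razborov's OR-polynomial ∘ exact block parities), so Razborov–Smolensky certifies only m ≳ n/polylog (OS15's single block); m > t/n³ ≥ n² needs a direct-sum step nobody has, and an AC⁰[3] packing is not excluded.
sources: doi:10.4230/LIPIcs.CCC.2015.124, ChattopadhyaySanthanam2012, DubrovIshai2006, FortnowSanthanam2011
[crux] AC⁰[p] rung (card's R2/C1, prime p ≠ 2): for t parity blocks of length n (n^5 ≤ t ≤ n^k) no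
family of m ≤ t/n³ single-output circuits over accBasis p of acDepth ≤ d and size ≤ (tn)^k has
OR-pure fibres — some x,y agree on all m outputs yet differ on [∃ block of odd parity]. Single-block
incompressibility (m < n/polylog by fixing t−1 blocks to even strings) is Oliveira–Santhanam CCC
2015 Thm 1.1 / ChattopadhyaySanthanam2012; the budget t/n³ ≥ n² is the OR-DIRECT-SUM content (the
card's own Smolensky count reaches only m·deg ≳ √(tn)). Consistent with coNP ⊄ NP/poly (FS counting
works for every m ≤ t−1). Sources: doi:10.4230/LIPIcs.CCC.2015.124; ChattopadhyaySanthanam2012;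
DubrovIshai2006; FortnowSanthanam2011. -/
@[route_item "route-PneNP-ORIncompressibility"]
def NoACCpCompressionParity : Prop :=
  ∀ p : ℕ, p.Prime → p ≠ 2 → ∀ d k : ℕ, ∃ n₀ : ℕ, ∀ n ≥ n₀, ∀ t m : ℕ, n ^ 5 ≤ t → t ≤ n ^ k → m * n ^ 3 ≤ t → ∀ C : Fin m → Literature.Computability.Complexity.Circuit (Fin (t * n)), (∀ j, (C j).IsOver (Literature.Computability.Complexity.accBasis p) ∧ (C j).acDepth ≤ d ∧ (C j).size ≤ (t * n) ^ k) → ∃ x y : Fin (t * n) → Bool, (∀ j, (C j).eval x = (C j).eval y) ∧ ¬ ((∃ i : Fin t, Literature.Computability.Complexity.parityFn n (fun l => x (finProdFinEquiv (i, l))) = true) ↔ ∃ i : Fin t, Literature.Computability.Complexity.parityFn n (fun l => y (finProdFinEquiv (i, l))) = true)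

/-- item stmt-PneNP-0987 · crux · rank 3 · open · by planner
why it might fail: Presumably TRUE (¬X believed false) but unprovable-looking: ¬X already gives coNP ⊆ NP/poly (FS11) and the UNIFORM NP ⊆ coAM (Drucker15 §9); the residue is derandomising that AM protocol, and AM = NP is known only from E-hardness — the opposite of an easiness hypothesis; census needs poly density.
sources: FortnowSanthanam2011, Drucker2015, doi:10.1137/130927115 §9 (Thm 9.2, Thm 9.16 full version), BoppanaHastadZachos1987, BuhrmanHitchcock2008, Literature.Computability.Complexity.orSAT_compressible_imp_coNP_subset_polyAdvice_NP
[crux] Uniformisation (card's C2): an FP OR-compression of SAT (¬NoORCompression) already gives NP =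
coNP — remove the advice from Fortnow–Santhanam/Drucker (whose conclusion is coNP ⊆ NP/poly), e.g.
by generating the reference tuples with the compressor itself plus derandomisation available under
the hypothesis. Tightens the sandwich to NP ≠ coNP ⇒ X ⇒ P ≠ NP. This is FS08's own open question.
Sources: FortnowSanthanam2011 (§7 open problems); Drucker2015. -/
@[route_item "route-PneNP-ORIncompressibility"]
def CompressionCollapse : Prop :=
  ¬ NoORCompression → Literature.Computability.Complexity.Nondeterministic.NP = Literature.Computability.Complexity.coNP

/-- item stmt-PneNP-0989 · support · rank 8 · closed · proved by Summit.PneNP.PneNP.Theorems.orIncompressibility_untouchedBlock_proof @ ae4c0eaf9e3a (prover) · by planner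
sources: FortnowSanthanam2011
[support] Untouched-block lemma, query model (card's R1 core; provable now, ~10 lines over
DecisionTree): if m decision trees of depth ≤ D on t·n bits satisfy m·D < t and n > 0, then with x =
0 (all block parities even) the trees read < t coordinates, some block is unread, and flipping one
of its bits gives y with identical tree outputs and an odd block. Sources: FortnowSanthanam2011
(setting); folklore. -/
@[route_item "route-PneNP-ORIncompressibility"]
def UntouchedBlock : Prop :=
  ∀ n t m D : ℕ, 0 < n → m * D < t → ∀ T : Fin m → Literature.Computability.Complexity.DecisionTree (t * n), (∀ j, (T j).depth ≤ D) → ∃ x y : Fin (t * n) → Bool, (∀ j, (T j).eval x = (T j).eval y) ∧ (∀ i : Fin t, Literature.Computability.Complexity.parityFn n (fun l => x (finProdFinEquiv (i, l))) = false) ∧ ∃ i : Fin t, Literature.Computability.Complexity.parityFn n (fun l => y (finProdFinEquiv (i, l))) = true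

/-- item stmt-PneNP-0990 · support · rank 8 · open · by planner
sources: Hastad2014, DubrovIshai2006, ChattopadhyaySanthanam2012
[support] AC⁰ rung (card's R1; theorem-level): for n³ ≤ t ≤ n^k parity blocks no family of m ≤ t/n²
single-output acBasis circuits of acDepth ≤ d, size ≤ (tn)^k is OR-pure. Route: Håstad's
multi-switching lemma (PROVED in tree: SwitchingLemma.multiSwitching, Hastad2014) turns the m
outputs into depth-O(k log tn) decision trees on the live variables while every block keeps a live
bit w.h.p.; set live bits to make all blocks even and apply UntouchedBlock. Single-block case also
follows from DubrovIshai2006/ChattopadhyaySanthanam2012. Sources: Hastad2014; DubrovIshai2006;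
ChattopadhyaySanthanam2012. -/
@[route_item "route-PneNP-ORIncompressibility"]
def NoAC0CompressionParity : Prop :=
  ∀ d k : ℕ, ∃ n₀ : ℕ, ∀ n ≥ n₀, ∀ t m : ℕ, n ^ 3 ≤ t → t ≤ n ^ k → m * n ^ 2 ≤ t → ∀ C : Fin m → Literature.Computability.Complexity.Circuit (Fin (t * n)), (∀ j, (C j).IsOver Literature.Computability.Complexity.acBasis ∧ (C j).acDepth ≤ d ∧ (C j).size ≤ (t * n) ^ k) → ∃ x y : Fin (t * n) → Bool, (∀ j, (C j).eval x = (C j).eval y) ∧ ¬ ((∃ i : Fin t, Literature.Computability.Complexity.parityFn n (fun l => x (finProdFinEquiv (i, l))) = true) ↔ ∃ i : Fin t, Literature.Computability.Complexity.parityFn n (fun l => y (finProdFinEquiv (i, l))) = true)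

/-- item stmt-PneNP-0991 · support · rank 9 · closed · proved by Summit.PneNP.PneNP.Theorems.orIncompressibility_oneBitCompressorOfNPSubsetP_proof @ 73bc45e537e1 (prover) · by planner
sources: FortnowSanthanam2011
[support] Assembly plumbing: NP ⊆ P → some f ∈ FP maps every tuple encoding xs.foldr boolPair [] to
the single bit [∃ x ∈ xs, x ∈ SAT]. Proof plan: the language {xs.foldr boolPair [] | ∃ x ∈ xs, x ∈
SAT} is in NP (witness = unary index + assignment; verifier iterates sndFn, takes fstFn, runs the
SAT verifier — SAT_mem_NP, PairProjections, IterateFP), hence in P; indicator functions of P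
languages are in FP (indicatorFn_mem_FP). Sources: AroraBarak2009 Thm 2.18 context;
FortnowSanthanam2011 §1. -/
@[route_item "route-PneNP-ORIncompressibility", crux]
def OneBitCompressorOfNPSubsetP : Prop :=
  Literature.Computability.Complexity.Nondeterministic.NP ⊆ Literature.Computability.Complexity.Classes.P → ∃ f ∈ Literature.Computability.Complexity.FP, ∀ xs : List (List Bool), ∃ b : Bool, f (xs.foldr Literature.Computability.Complexity.boolPair []) = [b] ∧ (b = true ↔ ∃ x ∈ xs, x ∈ Literature.Computability.Complexity.SAT)

/-- item stmt-PneNP-13975 · support · rank 9 · closed · proved by Summit.PneNP.PneNP.Theorems.orIncompressibility_noMonotoneCompressionClique_proof @ f157904e3a54 (prover) · by planner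
sources: FortnowSanthanam2011, doi:10.1016/j.ipl.2003.10.003, Tardos1988, Literature.Computability.Complexity.cliqueSqrt_monotone_lowerBound
[support] Monotone OR-incompressibility of CLIQUE tuples at the EXACT Fortnow–Santhanam budget
(provable now; route choice 2026-08-15, negation axis): for t ≤ v^k blocks — graphs on v vertices as
edge-indicator vectors over KEdge v — and ANY m < t, no family of m circuits over monotoneBasis =
{∧₂, ∨₂} of size ≤ (t·v)^k each has fibres pure for [∃ i, block i has a ⌊√v⌋-clique] (cliqueFn v
(Nat.sqrt v)). PROOF (block saturation, Jukna 2004's block-restriction move pointed at sketches):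
outputs f_j := (C j).eval are monotone (Circuit.monotone_eval_of_isOver_monotoneBasis); let On(x̄) =
{j | f_j x̄ = true} and M_q := max |On(x̄)| over clique-free tuples x̄ with at most q nonempty
blocks; M_0 ≤ M_1 ≤ … ≤ M_{m+1} ≤ m forces M_q = M_{q+1} for some q ≤ m < t; a maximiser x̄ (≤ q
nonempty blocks) has an empty block r; for clique-free G, x̄[r:=G] ≥ x̄ is clique-free with ≤ q+1
nonempty blocks, so On(x̄[r:=G]) ⊇ On(x̄) and |On(x̄[r:=G])| ≤ M_{q+1} = |On(x̄)|, i.e. NO output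
changes; for G' with a ⌊√v⌋-clique, purity (the negated conclusion) and monotonicity force some j ∉
On(x̄) to switch on (if On(x̄) = all of Fin m this is already a contradiction). Hence D(G) := ⋁_{j ∉
On(x̄)} f_j(x̄[r:=G]) -/
@[route_item "route-PneNP-ORIncompressibility"]
def NoMonotoneCompressionClique : Prop :=
  ∀ k : ℕ, ∃ v₀ : ℕ, ∀ v ≥ v₀, ∀ t m : ℕ, m < t → t ≤ v ^ k → ∀ C : Fin m → Literature.Computability.Complexity.Circuit (Fin t × Literature.Computability.Complexity.KEdge v), (∀ j, (C j).IsOver Literature.Computability.Complexity.monotoneBasis ∧ (C j).size ≤ (t * v) ^ k) → ∃ x y : Fin t × Literature.Computability.Complexity.KEdge v → Bool, (∀ j, (C j).eval x = (C j).eval y) ∧ ¬ ((∃ i : Fin t, Literature.Computability.Complexity.cliqueFn v (Nat.sqrt v) (fun e => x (i, e)) = true) ↔ ∃ i : Fin t, Literature.Computability.Complexity.cliqueFn v (Nat.sqrt v) (fun e => y (i, e)) = true)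

/-- item stmt-PneNP-13976 · support · rank 9 · closed · proved by Summit.PneNP.PneNP.Theorems.orIncompressibility_noNegLimitedCompressionClique_proof @ 7756539aecdf (prover) · by planner
sources: Markov1958, Fischer1975, AmanoMaruoka2005, doi:10.1016/j.ipl.2003.10.003, Jukna2012 §10.5 Claim 10.22, FortnowSanthanam2011
[support] Negation-limited OR-incompressibility of CLIQUE tuples (provable now; route choice
2026-08-15): for every constant NOT budget β and exponent k, for large v and m·v² ≤ t ≤ v^k (t > 0),
no family of m De Morgan circuits ({∧₂, ∨₂, ¬}), each with Circuit.negationCount ≤ β and size ≤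
(t·v)^k, has fibres pure for [∃ i, block i has a ⌊√v⌋-clique]. β = 0 is NoMonotoneCompressionClique;
at β = ⌈log₂(t·v²+1)⌉ per output the statement would be (Markov–Fischer) the full non-uniform
OR-incompressibility of CLIQUE, of coNP ⊄ NP/poly strength; the point of this item is that the block
surplus buys log₂(t/m) − O(1) negations per output by an ELEMENTARY argument, so the negation axis
adds no crux to this route (it is the single-function axis of route NegLimited shifted by log₂ of
the surplus — recorded as negative knowledge). PROOF (block saturation with frozen NOT gates, cf.
Jukna 2012 Claim 10.22 and the freezing surgery of NegationElimination.lean): write output j as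
M_j(x̄, y₁, …, y_b) with y_ℓ = ¬g_{j,ℓ}(x̄, y_{<ℓ}) the NOT gates in program order (b ≤ β), where
every g_{j,ℓ}(·, η) and M_j(·, η) (η a Boolean context) is a MONOTONE function of x̄ computed by a
sub-program with NOT gates -/
@[route_item "route-PneNP-ORIncompressibility"]
def NoNegLimitedCompressionClique : Prop :=
  ∀ β k : ℕ, ∃ v₀ : ℕ, ∀ v ≥ v₀, ∀ t m : ℕ, m * v ^ 2 ≤ t → 0 < t → t ≤ v ^ k → ∀ C : Fin m → Literature.Computability.Complexity.Circuit (Fin t × Literature.Computability.Complexity.KEdge v), (∀ j, (C j).IsOver Literature.Computability.Complexity.deMorganBasis ∧ (C j).negationCount ≤ β ∧ (C j).size ≤ (t * v) ^ k) → ∃ x y : Fin t × Literature.Computability.Complexity.KEdge v → Bool, (∀ j, (C j).eval x = (C j).eval y) ∧ ¬ ((∃ i : Fin t, Literature.Computability.Complexity.cliqueFn v (Nat.sqrt v) (fun e => x (i, e)) = true) ↔ ∃ i : Fin t, Literature.Computability.Complexity.cliqueFn v (Nat.sqrt v) (fun e => y (i, e)) = true)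

/-- item stmt-PneNP-0992 · assembly · rank 1 · closed · proved by Summit.PneNP.PneNP.Theorems.orIncompressibility_assembly_proof @ 1c9150fd923a (prover) · by planner
sources: FortnowSanthanam2011
[assembly] OneBitCompressorOfNPSubsetP → NoORCompression → PneNP: ¬PneNP ⇒ NP ⊆ P (proved bridges
P_bool_eq_holds, NP_bool_eq_holds via pneNP_shape_of_NP_not_subset_P) ⇒ the 1-bit compressor f; X at
a = 0 yields c and, for f, tuples xs ys with either 1 = |f| > n^0 (false) or f⟨xs⟩ = f⟨ys⟩ = [b]
with differing OR-bits — contradiction. Propositional glue checked in the planner sketch (rc 0).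
Sources: CookClay2006 §1; FortnowSanthanam2011. -/
@[route_item "route-PneNP-ORIncompressibility", crux]
def Assembly : Prop :=
  OneBitCompressorOfNPSubsetP → NoORCompression → PneNP

-- records of items no longer active in this route (dropped / restated):
-- earlier NoTC0CompressionSAT (stmt-PneNP-0988, dropped 2026-08-15T17:59:46Z): refuted by Summit.PneNP.PneNP.Theorems.ORIncompressibilityNoTC0CompressionSAT_refuted @ b199f26fbc0d — ∀ d k c c' : ℕ, c' < c → ∃ n₀ : ℕ, ∀ n ≥ n₀, ∀ m ≤ n ^ c', ∀ C : Fin m → Literature.Computability.Complexity.Circuit (Fin (n ^ c * n)), (∀ j, (C j).IsOver Literature.Computability.Complexity.tcBasis ∧ (C j).acDepth ≤ d ∧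

/-! D-0027 §2.1 — DECIDING THEOREM (planner-authored via `route open/edit --closes-file`; by planner-rbadge-PneNP-ORIncompressibility-d84dfd69-0 2026-08-15T17:59:46Z):
its hypotheses are this route's items and its conclusion the sub-problem Statement (glue_lint), and it elaborates with this file. -/

@[closes "route-PneNP-ORIncompressibility"] theorem closes (h_Assembly : Assembly) (h_OneBitCompressorOfNPSubsetP : OneBitCompressorOfNPSubsetP)
    (h_NoORCompression : NoORCompression) : _root_.PneNP :=
  h_Assembly h_OneBitCompressorOfNPSubsetP h_NoORCompression

end Summit.PneNP.PneNP.Theses.ORIncompressibility
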